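import Summits.MatrixMultiplication.MatrixMultiplication.Theorems.EdgePencilCore
import Summits.MatrixMultiplication.MatrixMultiplication.Theorems.TetraDiagonalLadder
import Summits.MatrixMultiplication.MatrixMultiplication.Theorems.TetrahedronTensorConsequences
import Literature.Computability.AlgebraicComplexity.RectangularExponentProofs
import HarnessLib

/-!
# The pencil exponent `ψ(ε)` and the diamond cut of `ω = 2`

Support kernel for `stmt-MatrixMultiplication-33477` (`TetraFlat : ω(K₄) ≤ 4`) of route
`TetrahedronCarving` (lineage `decomp-mm-lens-6`, generation 20), exponent layer of `EdgePencilCore`.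

`ψ(ε) = ω_pencil(ε) := inf {β | R₄(P_n^{(⌈n^ε⌉)}) = O(n^β)}`, the exponent of the tetrahedron with the
edge `01` DELETED and the opposite edge `23` of weight `ε` (`ψ(1)` = the diamond `K₄ - e`, `ψ(0)` = the
4-cycle). Results (every field unless `ℂ` is explicit):

* §1 bracket `4 ≤ ω(2,ε,2) ≤ ψ(ε) ≤ ω_diag(ε) ≤ ω(K₄)` (`ε ≤ 1`), monotone, saturation `ψ(ε) = ψ(1)`
  for `ε ≥ 1`;
* §2 the cover in exponents `ψ(ε) ≤ ω(1,ε,1) + 2` — so `ω(2,ε,2) = 2·ω(1,ε/2,1) ≤ ψ(ε) ≤ 2 + ω(1,ε,1)`: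
  the pencil is the dual-exponent profile of matrix multiplication, doubled from below and shifted
  from above; PROVED RUNGS `ψ(ε) = 4` for `0 ≤ ε ≤ α`, window `ψ(ε) ≤ 4 ⟹ ε/2 ≤ α`;
* §3 THE DIAMOND CUT `ω = 2 ⟺ (ψ(1) ≤ 4 ∧ ω + 2 ≤ ψ(1))`: `DiamondFlat := ψ(1) ≤ 4` is implied by
  `TetraFlat` (restriction) and still carries its whole recorded content (`ω(2,1,2) = 4`, `α ≥ 1/2`,
  `ω ≤ 12/5`); the residual is priced by the COVER (`ω + 2`), not by the flattening (`2ω`);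
* §4 off the diamond the cover-priced residual is the summit in costume: for `0 < ε < 1`,
  `4 + ε(ω - 2) ≤ ψ(ε) ⟺ ω = 2` (strict convexity of the dual-exponent profile below its chord, from
  `α > 0`); at `ε = 1` this argument is void — the diamond is the one pencil point whose chord residual
  `ω + 2 ≤ ψ(1)` is not reduced to `ω = 2` by the recorded inequalities.

References: Christandl–Vrana–Zuiddam, arXiv:1609.07476, Ex. 1.1.2, Prop. 1.1.16, Prop. 1.1.26
[ChristandlVranaZuiddam2016]; Lotti–Romani 1983 §1–§3 (convexity, subadditivity) [LottiRomani1983];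
Le Gall 2012 §1 (the dual exponent `α`) [LeGall2012]; Coppersmith 1982 (`α > 0.1722`) [Coppersmith1982].
-/

noncomputable section

set_option linter.dupNamespace false

open scoped BigOperators
open Filter Asymptotics
open Literature.Computability.AlgebraicComplexity
open Summit.MatrixMultiplication.MatrixMultiplication.Theorems.TetrahedronTensor
open Summit.MatrixMultiplication.MatrixMultiplication.Theorems.TetraDiagonal
open Summit.MatrixMultiplication.MatrixMultiplication.Theses.TetrahedronCarving

namespace Summit.MatrixMultiplication.MatrixMultiplication.Theorems.EdgePencil

/-! ## §1 The pencil exponent and its bracket -/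

section Defs

variable (F : Type) [Field F]

/-- Admissible exponents of the pencil family `n ↦ P_n^{(⌈n^ε⌉)}`. (CVZ19 Def. 1.1.13). -/
def pencilAdmissibleExponents (ε : ℝ) : Set ℝ :=
  {β : ℝ | (fun n : ℕ => (tensorRankD (pencil F n (rectDim n ε)) : ℝ)) =O[atTop]
    fun n : ℕ => (n : ℝ) ^ β}

/-- **The pencil exponent** `ψ(ε) = inf {β | R₄(P_n^{(⌈n^ε⌉)}) = O(n^β)}`; `ψ(1)` is the exponent of the
diamond `K₄ - e`, `ψ(0)` that of the 4-cycle. (CVZ19 Def. 1.1.25, non-uniform dimensions). -/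
def omegaPencil (ε : ℝ) : ℝ :=
  sInf (pencilAdmissibleExponents F ε)

end Defs

section Bracket

variable (F : Type) [Field F]

/-- Restriction: admissible for `Z^ε` ⟹ admissible for the pencil. -/
theorem diagAdmissibleExponents_subset_pencil (ε : ℝ) :
    diagAdmissibleExponents F ε ⊆ pencilAdmissibleExponents F ε := by
  intro β hβ
  refine IsBigO.trans ?_ hβ
  refine IsBigO.of_bound 1 (Eventually.of_forall fun n => ?_)
  rw [one_mul, Real.norm_of_nonneg (Nat.cast_nonneg _), Real.norm_of_nonneg (Nat.cast_nonneg _)]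
  exact_mod_cast tensorRankD_pencil_le_diagTetra (F := F) n (rectDim n ε)

/-- Grouping: admissible for the pencil (`ε ≤ 1`) ⟹ admissible for `⟨n², ⌈n^ε⌉, n²⟩`. -/
theorem pencilAdmissibleExponents_subset_rect {ε : ℝ} (hε1 : ε ≤ 1) :
    pencilAdmissibleExponents F ε ⊆ rectAdmissibleExponents F 2 ε 2 := by
  intro β hβ
  refine IsBigO.trans ?_ hβ
  refine IsBigO.of_bound 1 ?_
  filter_upwards [eventually_ge_atTop 1] with n hn
  rw [one_mul, Real.norm_of_nonneg (Nat.cast_nonneg _), Real.norm_of_nonneg (Nat.cast_nonneg _)]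
  haveI : NeZero n := ⟨by omega⟩
  have h2 : rectDim n 2 = n * n := by
    rw [show (2 : ℝ) = ((2 : ℕ) : ℝ) by norm_num, rectDim_natCast, pow_two]
  rw [tensorRank_matMulTensor_congr F h2 rfl h2]
  have hd : 0 < rectDim n ε := one_le_rectDim hn ε
  have hdN : rectDim n ε ≤ n := (rectDim_mono hn hε1).trans (rectDim_one n).le
  exact_mod_cast tensorRank_matMulTensor_le_tensorRankD_pencil (F := F) hd hdN

/-- Thinner kept edge is cheaper: `ε ≤ ε'` ⟹ admissible for `ε'` is admissible for `ε`. -/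
theorem pencilAdmissibleExponents_anti {ε ε' : ℝ} (h : ε ≤ ε') :
    pencilAdmissibleExponents F ε' ⊆ pencilAdmissibleExponents F ε := by
  intro β hβ
  refine IsBigO.trans ?_ hβ
  refine IsBigO.of_bound 1 ?_
  filter_upwards [eventually_ge_atTop 1] with n hn
  rw [one_mul, Real.norm_of_nonneg (Nat.cast_nonneg _), Real.norm_of_nonneg (Nat.cast_nonneg _)]
  exact_mod_cast tensorRankD_pencil_mono (F := F) (n := n) (rectDim_mono hn h)

/-- Saturation: for `ε ≥ 1` the pencil family is (eventually) the diamond family. -/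
theorem pencilAdmissibleExponents_of_one_le {ε : ℝ} (h : 1 ≤ ε) :
    pencilAdmissibleExponents F ε = pencilAdmissibleExponents F 1 := by
  have he : (fun n : ℕ => (tensorRankD (pencil F n (rectDim n ε)) : ℝ)) =ᶠ[atTop]
      fun n : ℕ => (tensorRankD (pencil F n (rectDim n 1)) : ℝ) := by
    filter_upwards [eventually_ge_atTop 1] with n hn
    have hle : n ≤ rectDim n ε := by simpa [rectDim_one] using rectDim_mono hn h
    rw [pencil_of_le hle, rectDim_one]
  ext β
  exact ⟨fun hβ => hβ.congr' he EventuallyEq.rfl, fun hβ => hβ.congr' he.symm EventuallyEq.rfl⟩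

/-- `6` is admissible for every pencil family (restriction of `T(K₄)`). -/
theorem pencilAdmissibleExponents_nonempty (ε : ℝ) : (pencilAdmissibleExponents F ε).Nonempty :=
  ⟨6, diagAdmissibleExponents_subset_pencil F ε
    (tetraAdmissibleExponents_subset_diag F ε (six_mem_tetraAdmissibleExponents F))⟩

/-- The admissible exponents of a pencil family (`ε ≤ 1`) are bounded below (grouping). -/
theorem pencilAdmissibleExponents_bddBelow {ε : ℝ} (hε1 : ε ≤ 1) :
    BddBelow (pencilAdmissibleExponents F ε) :=
  (rectAdmissibleExponents_bddBelow F 2 ε 2).mono (pencilAdmissibleExponents_subset_rect F hε1)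

/-- **`ψ(ε) ≤ ω_diag(ε)`** (`ε ≤ 1`). [folklore] -/
theorem omegaPencil_le_omegaDiag {ε : ℝ} (hε1 : ε ≤ 1) : omegaPencil F ε ≤ omegaDiag F ε :=
  csInf_le_csInf (pencilAdmissibleExponents_bddBelow F hε1) (diagAdmissibleExponents_nonempty F ε)
    (diagAdmissibleExponents_subset_pencil F ε)

/-- **`ψ(ε) ≤ ω(K₄)`** (`ε ≤ 1`). [folklore] -/
theorem omegaPencil_le_omegaTetra {ε : ℝ} (hε1 : ε ≤ 1) : omegaPencil F ε ≤ omegaTetra F :=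
  (omegaPencil_le_omegaDiag F hε1).trans (omegaDiag_le_omegaTetra F hε1)

/-- **`ω(2, ε, 2) ≤ ψ(ε)`** (`ε ≤ 1`; grouping the endpoints of the deleted edge). [folklore] -/
theorem omegaRect_two_mid_two_le_omegaPencil {ε : ℝ} (hε1 : ε ≤ 1) :
    omegaRect F 2 ε 2 ≤ omegaPencil F ε :=
  csInf_le_csInf (rectAdmissibleExponents_bddBelow F 2 ε 2) (pencilAdmissibleExponents_nonempty F ε)
    (pencilAdmissibleExponents_subset_rect F hε1)

/-- **`4 ≤ ψ(ε)`** (`ε ≤ 1`; information bound `2 + 2 ≤ ω(2,ε,2)`): even the 4-cycle is not cheaper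
than its flattening. [folklore] -/
theorem four_le_omegaPencil {ε : ℝ} (hε1 : ε ≤ 1) : 4 ≤ omegaPencil F ε := by
  have h := add_le_omegaRect₁₃ F 2 ε 2
  have h' := omegaRect_two_mid_two_le_omegaPencil F hε1
  norm_num at h
  linarith

/-- Monotone in `ε ≤ ε' ≤ 1`. [folklore] -/
theorem omegaPencil_mono {ε ε' : ℝ} (h : ε ≤ ε') (hε'1 : ε' ≤ 1) :
    omegaPencil F ε ≤ omegaPencil F ε' :=
  csInf_le_csInf (pencilAdmissibleExponents_bddBelow F (h.trans hε'1))
    (pencilAdmissibleExponents_nonempty F ε') (pencilAdmissibleExponents_anti F h)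

/-- Saturation in exponents: `ψ(ε) = ψ(1)` for `ε ≥ 1` (the diamond). -/
theorem omegaPencil_of_one_le {ε : ℝ} (h : 1 ≤ ε) : omegaPencil F ε = omegaPencil F 1 := by
  unfold omegaPencil
  rw [pencilAdmissibleExponents_of_one_le F h]

end Bracket

/-! ## §2 The cover in exponents, the proved rungs and the window -/

section Cover

variable (F : Type) [Field F]

/-- **`β` admissible for `(1, ε, 1)` ⟹ `β + 2` admissible for the pencil**, at every `ε`: the finite
cover `R₄(P_n^{(d)}) ≤ R(⟨n,d,n⟩)·n²` at `d = ⌈n^ε⌉`. [cite: ChristandlVranaZuiddam2016, Prop. 1.1.26] -/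
theorem add_two_mem_pencilAdmissibleExponents {ε β : ℝ}
    (hβ : β ∈ rectAdmissibleExponents F 1 ε 1) : β + 2 ∈ pencilAdmissibleExponents F ε := by
  obtain ⟨C, hC0, hC⟩ := bound_of_isBigO_nat_atTop hβ
  refine IsBigO.of_bound C ?_
  filter_upwards [eventually_ge_atTop 1] with n hn
  have hn0 : (0 : ℝ) < n := by exact_mod_cast hn
  have hR : (tensorRank (matMulTensor F n (rectDim n ε) n) : ℝ) ≤ C * (n : ℝ) ^ β := by
    have h := hC (Real.rpow_pos_of_pos hn0 β).ne'
    rwa [Real.norm_of_nonneg (Nat.cast_nonneg _), Real.norm_of_nonneg (Real.rpow_nonneg hn0.le _),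
      tensorRank_matMulTensor_congr F (rectDim_one n) rfl (rectDim_one n)] at h
  rw [Real.norm_of_nonneg (Nat.cast_nonneg _), Real.norm_of_nonneg (Real.rpow_nonneg hn0.le _),
    Real.rpow_add hn0, Real.rpow_two, ← mul_assoc]
  have hfin := tensorRankD_pencil_le_cover (F := F) n (rectDim n ε)
  calc (tensorRankD (pencil F n (rectDim n ε)) : ℝ)
      ≤ (tensorRank (matMulTensor F n (rectDim n ε) n) : ℝ) * ((n : ℝ) * n) := by exact_mod_cast hfin
    _ ≤ C * (n : ℝ) ^ β * ((n : ℝ) * n) := mul_le_mul_of_nonneg_right hR (by positivity)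
    _ = C * (n : ℝ) ^ β * (n : ℝ) ^ 2 := by ring

/-- **The cover in exponents `ψ(ε) ≤ ω(1, ε, 1) + 2`** (`ε ≤ 1`): triangle `023` of shape `(1, ε, 1)`
times the flat cherry at vertex `1`. With the grouping floor: `2·ω(1,ε/2,1) = ω(2,ε,2) ≤ ψ(ε) ≤ 2 + ω(1,ε,1)`.
[cite: ChristandlVranaZuiddam2016, Prop. 1.1.26] -/
theorem omegaPencil_le_omegaRect_add_two {ε : ℝ} (hε1 : ε ≤ 1) :
    omegaPencil F ε ≤ omegaRect F 1 ε 1 + 2 := by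
  have h : ∀ β ∈ rectAdmissibleExponents F 1 ε 1, omegaPencil F ε - 2 ≤ β := fun β hβ => by
    have h2 := csInf_le (pencilAdmissibleExponents_bddBelow F hε1)
      (add_two_mem_pencilAdmissibleExponents F hβ)
    change omegaPencil F ε ≤ β + 2 at h2
    linarith
  have h3 := le_csInf (rectAdmissibleExponents_nonempty F 1 ε 1) h
  change omegaPencil F ε - 2 ≤ omegaRect F 1 ε 1 at h3
  linarith

/-- **The diamond cover `ψ(1) ≤ ω + 2`** (`T(K₄ - e) ≤ ⟨n,n,n⟩ ⊗ ⟨n, 1, n⟩`).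
[cite: ChristandlVranaZuiddam2016, Prop. 1.1.26] -/
theorem omegaPencil_one_le_omega_add_two : omegaPencil F 1 ≤ omega F + 2 := by
  have h := omegaPencil_le_omegaRect_add_two F le_rfl
  rwa [omegaRect_one_one_one] at h

/-- **Proved rungs**: `ψ(ε) = 4` for every `0 ≤ ε ≤ α` — the pencil is FLAT up to the dual exponent, a
decided instance of the item's family in a regime where `ω = 2` is not known. [cite: LeGall2012, §1] -/
theorem omegaPencil_eq_four_of_le_dualExponentAlpha {ε : ℝ} (hε : ε ≤ dualExponentAlpha F) :
    omegaPencil F ε = 4 := by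
  have hε1 : ε ≤ 1 := hε.trans (dualExponentAlpha_le_one F)
  refine le_antisymm ?_ (four_le_omegaPencil F hε1)
  have h := omegaPencil_le_omegaRect_add_two F hε1
  rw [omegaRect_eq_two_of_le_dualExponentAlpha F hε] at h
  linarith

/-- `ψ(ε) ≤ 4 ↔ ψ(ε) = 4` (`ε ≤ 1`). -/
theorem omegaPencil_le_four_iff {ε : ℝ} (hε1 : ε ≤ 1) : omegaPencil F ε ≤ 4 ↔ omegaPencil F ε = 4 :=
  ⟨fun h => le_antisymm h (four_le_omegaPencil F hε1), fun h => h.le⟩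

/-- **Shadow of a pencil rung**: `ψ(ε) ≤ 4 ⟹ ω(2, ε, 2) = 4`. [folklore] -/
theorem omegaRect_two_mid_two_eq_four_of_omegaPencil_le_four {ε : ℝ} (hε1 : ε ≤ 1)
    (h : omegaPencil F ε ≤ 4) : omegaRect F 2 ε 2 = 4 := by
  refine le_antisymm ((omegaRect_two_mid_two_le_omegaPencil F hε1).trans h) ?_
  have h4 := add_le_omegaRect₁₃ F 2 ε 2
  norm_num at h4
  exact h4

/-- **Shadow on the dual exponent**: `ψ(ε) ≤ 4 ⟹ ε/2 ≤ α` (`0 ≤ ε ≤ 1`; homogeneity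
`ω(2,ε,2) = 2·ω(1,ε/2,1)`). [cite: LeGall2012, §1] -/
theorem half_eps_le_dualExponentAlpha_of_omegaPencil_le_four {ε : ℝ} (hε0 : 0 ≤ ε) (hε1 : ε ≤ 1)
    (h : omegaPencil F ε ≤ 4) : ε / 2 ≤ dualExponentAlpha F := by
  have hs := omegaRect_smul (K := F) (t := 2) (by norm_num) (a := 1) (b := ε / 2) (c := 1)
    (by norm_num) (by linarith) (by norm_num)
  have h2 : ((2 : ℕ) : ℝ) * (ε / 2) = ε := by push_cast; ring
  have h1 : ((2 : ℕ) : ℝ) * 1 = 2 := by norm_num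
  rw [h2, h1, omegaRect_two_mid_two_eq_four_of_omegaPencil_le_four F hε1 h] at hs
  have h22 : ((2 : ℕ) : ℝ) = 2 := by norm_num
  rw [h22] at hs
  exact le_dualExponentAlpha (K := F) ⟨by linarith, by linarith⟩ (by linarith)

/-- **The rung window of the pencil**: `ε ≤ α ⟹ ψ(ε) = 4 ⟹ ε/2 ≤ α` (`0 ≤ ε ≤ 1`): the flat frontier
`sup {ε | ψ(ε) = 4}` lies in `[α, 2α]`. [cite: LeGall2012, §1] -/
theorem omegaPencil_rung_window {ε : ℝ} (hε0 : 0 ≤ ε) (hε1 : ε ≤ 1) :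
    (ε ≤ dualExponentAlpha F → omegaPencil F ε ≤ 4) ∧
      (omegaPencil F ε ≤ 4 → ε / 2 ≤ dualExponentAlpha F) :=
  ⟨fun h => (omegaPencil_eq_four_of_le_dualExponentAlpha F h).le,
    half_eps_le_dualExponentAlpha_of_omegaPencil_le_four F hε0 hε1⟩

end Cover

/-! ## §3 The diamond cut -/

section Diamond

variable (F : Type) [Field F]

/-- **`DiamondFlat` consequences** (`ψ(1) ≤ 4`, every field): `ω(2,1,2) = 4`, `α ≥ 1/2` and `ω ≤ 12/5`
— the whole recorded content of `TetraFlat` (`TetrahedronTensorConsequences`) already follows from the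
flatness of the diamond. [cite: LottiRomani1983, §1 (p. 173)] -/
theorem diamondFlat_consequences (h : omegaPencil F 1 ≤ 4) :
    omegaRect F 2 1 2 = 4 ∧ 1 / 2 ≤ dualExponentAlpha F ∧ omega F ≤ 12 / 5 := by
  have h212 := omegaRect_two_mid_two_eq_four_of_omegaPencil_le_four F le_rfl h
  refine ⟨h212, half_eps_le_dualExponentAlpha_of_omegaPencil_le_four F zero_le_one le_rfl h, ?_⟩
  have h122 : omegaRect F 1 2 2 = 4 := by rw [← omegaRect_swap₁₂ F 2 1 2]; exact h212
  have h221 : omegaRect F 2 2 1 = 4 := by rw [← omegaRect_swap₂₃ F 2 1 2]; exact h212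
  have hsub1 := LottiRomani1983_subadditive F 1 2 2 2 1 2
  have hsub2 := LottiRomani1983_subadditive F (1 + 2) (2 + 1) (2 + 2) 2 2 1
  have hhom := LottiRomani1983_homogeneous F (ν := 5) (x := 1) (y := 1) (z := 1)
    (by norm_num) (by norm_num) (by norm_num) (by norm_num)
  rw [omegaRect_one_one_one] at hhom
  have e5 : omegaRect F (1 + 2 + 2) (2 + 1 + 2) (2 + 2 + 1) = omegaRect F (5 * 1) (5 * 1) (5 * 1) := by
    norm_num
  linarith

/-- **`TetraFlat ⟹ DiamondFlat`** (restriction: the diamond is a sub-tensor of the tetrahedron), and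
more generally `TetraFlat ⟹ ψ(ε) ≤ 4` for every `ε ≤ 1`. -/
theorem omegaPencil_le_four_of_tetraFlat (h : TetraFlat) {ε : ℝ} (hε1 : ε ≤ 1) :
    omegaPencil ℂ ε ≤ 4 :=
  (omegaPencil_le_omegaTetra ℂ hε1).trans h

/-- **THE DIAMOND CUT**: `ω = 2 ⟺ (ψ(1) ≤ 4 ∧ ω + 2 ≤ ψ(1))` — flatness of the diamond `K₄ - e` AND no
saving over its triangle-times-cherry cover. Both pieces are necessary; the second is the residual
priced by the cover value `ω + 2` (not by the flattening value, `2ω ≤ ψ(1)`, which would be the summit in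
costume since `ψ(1) ≤ ω + 2 < 2ω` unless `ω = 2`). -/
theorem matrixMultiplication_iff_diamond :
    _root_.MatrixMultiplication ↔ omegaPencil ℂ 1 ≤ 4 ∧ omega ℂ + 2 ≤ omegaPencil ℂ 1 := by
  constructor
  · intro hS
    have hω : omega ℂ = 2 := _root_.MatrixMultiplication_iff.1 hS
    have hc := omegaPencil_one_le_omega_add_two ℂ
    have h4 := four_le_omegaPencil ℂ (le_refl (1 : ℝ))
    constructor <;> linarith
  · rintro ⟨hflat, hres⟩
    have h2 := omega_two_le ℂ
    exact _root_.MatrixMultiplication_iff.2 (le_antisymm (by linarith) h2)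

/-- The flattening-priced diamond residual `2ω ≤ ψ(1)` is the summit in costume. -/
theorem two_mul_omega_le_omegaPencil_one_iff :
    2 * omega ℂ ≤ omegaPencil ℂ 1 ↔ _root_.MatrixMultiplication := by
  constructor
  · intro h
    have hc := omegaPencil_one_le_omega_add_two ℂ
    exact _root_.MatrixMultiplication_iff.2 (le_antisymm (by linarith) (omega_two_le ℂ))
  · intro hS
    have hω : omega ℂ = 2 := _root_.MatrixMultiplication_iff.1 hS
    have h4 := four_le_omegaPencil ℂ (le_refl (1 : ℝ))
    linarith

/-- Every pencil rung is NECESSARY: `ω = 2 ⟹ ψ(ε) = 4` for every `ε ≤ 1`. -/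
theorem omegaPencil_eq_four_of_matrixMultiplication (hS : _root_.MatrixMultiplication) {ε : ℝ}
    (hε1 : ε ≤ 1) : omegaPencil ℂ ε = 4 :=
  (omegaPencil_le_four_iff ℂ hε1).1
    (omegaPencil_le_four_of_tetraFlat (omegaTetra_le_four_of_matrixMultiplication hS) hε1)

/-- **The diamond cut against the route's cut**: `TetraFlat ⟹ DiamondFlat`, and under `TetraFlat` the
route's residual `TetraNoSaving` implies the diamond residual (both are then `ω = 2`). -/
theorem diamond_of_tetrahedronCarving (hA : TetraFlat) (hB : TetraNoSaving) :
    omegaPencil ℂ 1 ≤ 4 ∧ omega ℂ + 2 ≤ omegaPencil ℂ 1 := by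
  have hω : omega ℂ ≤ 2 := by
    have h := hB
    unfold TetraNoSaving at h
    unfold TetraFlat at hA
    linarith
  have hS : _root_.MatrixMultiplication :=
    _root_.MatrixMultiplication_iff.2 (le_antisymm hω (omega_two_le ℂ))
  exact matrixMultiplication_iff_diamond.1 hS

end Diamond

/-! ## §4 Off the diamond, the cover-priced residual is the summit in costume -/

section Chord

variable (F : Type) [Field F]

/-- **Strict convexity below the chord** (given `α > 0`, discharged over every field by the tree's
`coppersmith1982_dualExponentAlpha_gt : 0.1722 < α` of `Coppersmith1982RapidRectangular`, not imported
here): for `0 < ε < 1`, `2 + ε(ω - 2) ≤ ω(1, ε, 1)` forces `ω = 2`. (Lotti–Romani convexity of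
`k ↦ ω(1,k,1)` on `[α, 1]` between `ω(1,α,1) = 2` and `ω(1,1,1) = ω`: the three-slope inequality.)
[cite: LottiRomani1983, §3 (p. 179)] [cite: Coppersmith1982, Theorem] -/
theorem omega_eq_two_of_chord_le_omegaRect (hα0 : 0 < dualExponentAlpha F) {ε : ℝ} (hε0 : 0 < ε)
    (hε1 : ε < 1) (h : 2 + ε * (omega F - 2) ≤ omegaRect F 1 ε 1) : omega F = 2 := by
  have h2 := omega_two_le F
  refine le_antisymm ?_ h2
  rcases le_or_gt ε (dualExponentAlpha F) with hle | hlt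
  · -- inside the flat segment: `ω(1,ε,1) = 2`
    rw [omegaRect_eq_two_of_le_dualExponentAlpha F hle] at h
    nlinarith
  · -- three-slope inequality at `α < ε < 1`
    have hconv := omegaRect_convexOn_middle_holds F
    have hs := hconv.slope_mono_adjacent (Set.mem_Ici.2 hα0.le)
      (Set.mem_Ici.2 (zero_le_one : (0 : ℝ) ≤ 1)) hlt hε1
    rw [omegaRect_eq_two_of_le_dualExponentAlpha F le_rfl, omegaRect_one_one_one] at hs
    rw [div_le_div_iff₀ (by linarith) (by linarith)] at hs
    -- `hs : (ω(1,ε,1) - 2)(1 - ε) ≤ (ω - ω(1,ε,1))(ε - α)`; with `h` twice this sums to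
    -- `α (1 - ε) (ω - 2) ≤ 0`
    by_contra hgt
    have hgt' : 2 < omega F := not_le.1 hgt
    have hprod : 0 < (omega F - 2) * (1 - ε) * dualExponentAlpha F :=
      mul_pos (mul_pos (sub_pos.2 hgt') (sub_pos.2 hε1)) hα0
    nlinarith [mul_nonneg (sub_nonneg.2 h) (sub_nonneg.2 hε1.le),
      mul_nonneg (sub_nonneg.2 h) (sub_nonneg.2 hlt.le), hprod, hs]

/-- **The chord residual off the diamond is a costume**: for `0 < ε < 1` the cover-priced residual of the
pencil, `4 + ε(ω - 2) ≤ ψ(ε)` (no saving over triangle `(1,ε,1)` priced on the chord, times the cherry),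
already implies `ω = 2`. At `ε = 1` the same residual reads `ω + 2 ≤ ψ(1)` and this argument is void.
[cite: LottiRomani1983, §3 (p. 179)] -/
theorem omega_eq_two_of_chord_le_omegaPencil (hα0 : 0 < dualExponentAlpha F) {ε : ℝ} (hε0 : 0 < ε)
    (hε1 : ε < 1) (h : 4 + ε * (omega F - 2) ≤ omegaPencil F ε) : omega F = 2 :=
  omega_eq_two_of_chord_le_omegaRect F hα0 hε0 hε1
    (by have hc := omegaPencil_le_omegaRect_add_two F hε1.le; linarith)

/-- Over `ℂ`: for `0 < ε < 1`, `4 + ε(ω - 2) ≤ ψ(ε) ⟺ ω = 2`; contrast `matrixMultiplication_iff_diamond`. -/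
theorem chord_le_omegaPencil_iff (hα0 : 0 < dualExponentAlpha ℂ) {ε : ℝ} (hε0 : 0 < ε) (hε1 : ε < 1) :
    4 + ε * (omega ℂ - 2) ≤ omegaPencil ℂ ε ↔ _root_.MatrixMultiplication := by
  constructor
  · exact fun h =>
      _root_.MatrixMultiplication_iff.2 (omega_eq_two_of_chord_le_omegaPencil ℂ hα0 hε0 hε1 h)
  · intro hS
    have hω : omega ℂ = 2 := _root_.MatrixMultiplication_iff.1 hS
    have h4 := four_le_omegaPencil ℂ hε1.le
    rw [hω]
    linarith

end Chord

end Summit.MatrixMultiplication.MatrixMultiplication.Theorems.EdgePencil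

end
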